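import Mathlib
import HarnessLib

/-!
# Rescaled bump functions `φ_s(x) = φ(s x)` and the scale invariance of the first gradient moment of the mollifier

Analysis/FunctionSpaces support file.  For the DiPerna–Lions commutator lemma (tree `SobolevGradCommutatorL1`,
DiPerna–Lions 1989 Lemma II.1) one mollifies with the RESCALED kernels `k_s(x) = s^d k(s x)` of ONE bump: the
commutator bound carries the constant `∫ ‖z‖‖∇k_s(z)‖ dz`, which must not depend on `s`.  Mathlib's
`ContDiffBump` carries no rescaling; this file provides it:

* `bumpRescale φ hs` (`0 < s`): the bump with radii `rIn/s`, `rOut/s`; `rescale_apply : bumpRescale φ hs x = φ (s • x)`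
  (same base profile, by `ContDiffBump.apply`);
* `integral_bumpRescale`, `normed_bumpRescale_apply : (bumpRescale φ hs).normed μ x = s^d · φ.normed μ (s • x)` (`d = finrank ℝ E`,
  Haar scaling `Measure.integral_comp_smul`);
* `gradient_normed_bumpRescale : ∇((bumpRescale φ hs).normed μ) z = s^d · s · ∇(φ.normed μ)(s • z)` (`fderiv_comp_smul`);
* `integral_norm_mul_norm_gradient_normed_bumpRescale` — **scale invariance**:
  `∫ ‖z‖‖∇((bumpRescale φ hs).normed μ) z‖ dz = ∫ ‖z‖‖∇(φ.normed μ) z‖ dz`.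

[folklore; cite: DiPernaLions1989, Lemma II.1 (proof: the rescaled mollifier)]
-/

noncomputable section

open MeasureTheory Set Filter Metric Function Module
open scoped ENNReal NNReal InnerProductSpace Topology RealInnerProductSpace

namespace Literature.Analysis.FunctionSpaces

section Rescale

variable {E : Type*} [NormedAddCommGroup E] [NormedSpace ℝ E] [HasContDiffBump E]

/-- The rescaled bump `x ↦ φ(s x)`, `0 < s`, as a `ContDiffBump` (radii `rIn/s < rOut/s`) — the standard mollifier family
`η_ε(x) = ε^{-n} η(x/ε)` before normalisation, `s = ε⁻¹`. [cite: Evans2010, Appendix C.4 (standard mollifier η_ε)] -/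
def bumpRescale (φ : ContDiffBump (0 : E)) {s : ℝ} (hs : 0 < s) : ContDiffBump (0 : E) :=
  ⟨φ.rIn / s, φ.rOut / s, div_pos φ.rIn_pos hs, div_lt_div_of_pos_right φ.rIn_lt_rOut hs⟩

variable (φ : ContDiffBump (0 : E)) {s : ℝ} (hs : 0 < s)

omit [NormedSpace ℝ E] [HasContDiffBump E] in
/-- Outer radius of the rescaled bump (`ε·rOut`, `s = ε⁻¹`). [cite: Evans2010, Appendix C.4 (standard mollifier η_ε)] -/
@[simp] theorem bumpRescale_rOut : (bumpRescale φ hs).rOut = φ.rOut / s := rfl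

omit [NormedSpace ℝ E] [HasContDiffBump E] in
/-- Inner radius of the rescaled bump. [cite: Evans2010, Appendix C.4 (standard mollifier η_ε)] -/
@[simp] theorem bumpRescale_rIn : (bumpRescale φ hs).rIn = φ.rIn / s := rfl

/-- `bumpRescale φ hs x = φ (s • x)` (`η(x/ε)`). [cite: Evans2010, Appendix C.4 (standard mollifier η_ε)] -/
theorem bumpRescale_apply (x : E) : bumpRescale φ hs x = φ (s • x) := by
  rw [ContDiffBump.apply, ContDiffBump.apply]
  have hr : (bumpRescale φ hs).rOut / (bumpRescale φ hs).rIn = φ.rOut / φ.rIn := by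
    rw [bumpRescale_rOut, bumpRescale_rIn]
    field_simp [φ.rIn_pos.ne', hs.ne']
  have hx : (bumpRescale φ hs).rIn⁻¹ • (x - 0) = φ.rIn⁻¹ • (s • x - 0) := by
    rw [bumpRescale_rIn, sub_zero, sub_zero, smul_smul]
    congr 1
    field_simp
  rw [hr, hx]

end Rescale

section Haar

variable {E : Type*} [NormedAddCommGroup E] [InnerProductSpace ℝ E] [FiniteDimensional ℝ E]
  [MeasurableSpace E] [BorelSpace E] (μ : Measure E) [μ.IsAddHaarMeasure]
variable (φ : ContDiffBump (0 : E)) {s : ℝ} (hs : 0 < s)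

/-- `∫ φ(s x) dx = (s^d)⁻¹ ∫ φ` (Haar scaling). [cite: Evans2010, Appendix C.4 (standard mollifier η_ε: ∫ η_ε = 1)] -/
theorem integral_bumpRescale : ∫ x, bumpRescale φ hs x ∂μ = (s ^ finrank ℝ E)⁻¹ * ∫ x, φ x ∂μ := by
  simp_rw [bumpRescale_apply]
  rw [Measure.integral_comp_smul, smul_eq_mul, abs_of_pos (inv_pos.2 (pow_pos hs _))]

/-- The normalised rescaled bump is the rescaled mollifier: `(bumpRescale φ hs).normed μ x = s^d · φ.normed μ (s • x)`
(`η_ε = ε^{-n}η(·/ε)`). [cite: Evans2010, Appendix C.4 (standard mollifier η_ε)] -/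
theorem normed_bumpRescale_apply (x : E) :
    (bumpRescale φ hs).normed μ x = s ^ finrank ℝ E * φ.normed μ (s • x) := by
  rw [ContDiffBump.normed_def, ContDiffBump.normed_def, integral_bumpRescale, bumpRescale_apply]
  have hI : 0 < ∫ x, φ x ∂μ := φ.integral_pos
  have hsd : 0 < s ^ finrank ℝ E := pow_pos hs _
  field_simp

/-- The normalised rescaled bump as a function: `(bumpRescale φ hs).normed μ = fun x => s^d · φ.normed μ (s • x)`.
[cite: Evans2010, Appendix C.4 (standard mollifier η_ε)] -/
theorem normed_bumpRescale_eq :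
    (bumpRescale φ hs).normed μ = fun x => s ^ finrank ℝ E * φ.normed μ (s • x) :=
  funext fun x => normed_bumpRescale_apply μ φ hs x

/-- The gradient of the rescaled mollifier: `∇((bumpRescale φ hs).normed μ) z = (s^d · s) • ∇(φ.normed μ)(s • z)`
(`∇η_ε = ε^{-n-1}(∇η)(·/ε)`). [cite: DiPernaLions1989, Lemma II.1 (proof: the rescaled mollifier)] -/
theorem gradient_normed_bumpRescale (z : E) :
    gradient ((bumpRescale φ hs).normed μ) z = (s ^ finrank ℝ E * s) • gradient (φ.normed μ) (s • z) := by
  rw [normed_bumpRescale_eq]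
  have hd : DifferentiableAt ℝ (fun x : E => φ.normed μ (s • x)) z :=
    (φ.contDiff_normed (n := 1)).differentiable one_ne_zero |>.differentiableAt.comp z
      ((differentiableAt_id).const_smul s)
  have e1 : gradient (fun x => s ^ finrank ℝ E * φ.normed μ (s • x)) z =
      s ^ finrank ℝ E • gradient (fun x => φ.normed μ (s • x)) z := by
    unfold gradient
    rw [fderiv_const_mul hd, map_smul]
  have e2 : gradient (fun x => φ.normed μ (s • x)) z = s • gradient (φ.normed μ) (s • z) := by
    unfold gradient
    rw [show (fun x => φ.normed μ (s • x)) = (fun x => φ.normed μ x) ∘ (fun x => s • x) from rfl]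
    change (InnerProductSpace.toDual ℝ E).symm (fderiv ℝ (φ.normed μ <| s • ·) z) = _
    rw [fderiv_comp_smul, map_smul]
  rw [e1, e2, smul_smul]

/-- **Scale invariance of the first gradient moment of the mollifier**:
`∫ ‖z‖‖∇((bumpRescale φ hs).normed μ)(z)‖ dz = ∫ ‖z‖‖∇(φ.normed μ)(z)‖ dz` — the constant of the DiPerna–Lions commutator bound
(`lintegral_enorm_gradCommutator_le`) does not depend on the mollification scale. [cite: DiPernaLions1989, Lemma II.1 (proof)] -/
theorem integral_norm_mul_norm_gradient_normed_bumpRescale :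
    ∫ z, ‖z‖ * ‖gradient ((bumpRescale φ hs).normed μ) z‖ ∂μ = ∫ z, ‖z‖ * ‖gradient (φ.normed μ) z‖ ∂μ := by
  simp_rw [gradient_normed_bumpRescale, norm_smul]
  have hsd : 0 < s ^ finrank ℝ E := pow_pos hs _
  have e : ∀ z : E, ‖z‖ * (‖s ^ finrank ℝ E * s‖ * ‖gradient (φ.normed μ) (s • z)‖) =
      (fun w : E => s ^ finrank ℝ E * (‖w‖ * ‖gradient (φ.normed μ) w‖)) (s • z) := fun z => by
    simp only [norm_smul, Real.norm_of_nonneg hs.le, Real.norm_of_nonneg (mul_pos hsd hs).le]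
    ring
  simp_rw [e]
  rw [Measure.integral_comp_smul μ (fun w : E => s ^ finrank ℝ E * (‖w‖ * ‖gradient (φ.normed μ) w‖)) s,
    integral_const_mul, smul_eq_mul, abs_of_pos (inv_pos.2 hsd), ← mul_assoc, inv_mul_cancel₀ hsd.ne', one_mul]

end Haar

end Literature.Analysis.FunctionSpaces

end
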